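/-
Copyright: literature formalisation for the harness. Statements follow the cited text.
-/
import Literature.AlgebraicGeometry.CossartPiltant200819.NormalModelAbove2008
import HarnessLib

/-!
# Cossart–Piltant 2008, Lemma 9.4 (journal 9.2), case `e = l`: Fu's primary contraction over an
arbitrary ground field, via Prop 8.1

V. Cossart, O. Piltant, *Resolution of singularities of threefolds in positive characteristic I*,
J. Algebra 320 (2008) 1051–1082 [CossartPiltant2008]; manuscript hal-00139124 ("HAL"). Sequel
of `StableModelCriterion2008.lean`. There, the stability statement (S3\*) used without proof at
HAL p. 30, l. 14–16 of the printed proof of Lemma 9.4 (`GStableUniformizationAbove`, asked only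
for inertial `W`: `GStableUniformizationInertial`) is derived, for **`k` algebraically closed**
and rational rank `≥ 2`, from [Fu1997, Thm 3.6] (`FuPrimaryTransform`: a local uniformization
`S` of `W` with `(m_S ∩ K)S` primary for `m_S`) and the criterion `ConjugateStability`. The
hypothesis `k = k̄` is Fu's standing hypothesis (J. Algebra 194, §3, p. 624); the ground field of
[CossartPiltant2008] §§3–9 is an arbitrary field `k` of characteristic `p > 0` (Theorem 2.1: `k`
differentially finite over a perfect subfield), and its resolution theorem is reduced "to local
uniformization of rank one, residually algebraic valuations" (HAL p. 3, l. 17–18), so `κ(W) ⊋ k`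
occurs as soon as `k ≠ k̄`. This file records WHERE `k = k̄` enters
Fu's proof and that, in the setting of Lemma 9.4 (`W` of rank one, `κ(W)/k` algebraic,
transcendence degree three, LU(`W`)), [CossartPiltant2008] **Prop 8.1** (`MonomialUniformization`,
any `k`) supplies exactly what those steps supply. The resulting statement
`PrimaryTransformRankOne` — Fu's Theorem 3.6 for `n = 3`, `r ≥ 2`, WITHOUT `k = k̄`, WITH `W` of
rank one — is NOT a printed theorem: it is this formalisation's transport, entered as a named
hypothesis whose docstring below is the transported proof, step by step, with the printed
sources of each step. PROVED here: the bookkeeping ((S3\*) and Lemma 9.4 for rational rank `≥ 2`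
over any `k` from that hypothesis, printed statements and `ConjugateStability`; the full lemma
from the same leaves plus the rational-rank-one residual `GStableUniformizationInertialRankOne`)
and the terminal step of Fu's proof for `r = 3` (`contractedCentrePrimary_of_dagger`: Fu's
relations (†) for all three parameters force `(m_S ∩ K)S` to be `m_S`-primary). The last section
discharges the leaf `NormalModelAboveLe` (`R̃₀` is a local model of `W`, HAL §3 / Prop 6.2) by
the theorem `normalModelAboveLe_holds` of `NormalModelAbove2008.lean`, so that Lemma 9.4 over
any `k` rests on printed statements (`DescentBelowInertiaField`, `TamePrimeDescentViaStableModel`,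
`Cofinality`), the criterion `ConjugateStability`, the transport `PrimaryTransformRankOne` and
the rational-rank-one residual `GStableUniformizationInertialRankOne` — nothing else.

## Where `k = k̄` is used in [Fu1997, §3], and the replacement

Fu's proof of Thm 3.6 (p. 627–629) consists of: Reduction 3.7 (Abhyankar; uses Fact 3.1 =
domination [Shannon1973, 4.5] and normality of `S`); Prop 3.8 (uses Fact 3.1 and **Prop 3.5**);
and, for part (2), an argument on p. 628, l. −12 – p. 629 using only Lemma 1.4, Cor 2.4, (†),
normality of `R = S ∩ K`, `S` a UFD and `S/P` regular. The field `k` enters ONLY through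
Props 3.3 and 3.5 (p. 624–626: monoidal transforms centred at `(x_a, x_b - c x_a)`, `c ∈ k`, need
`V` residually rational over `S` with `k` a coefficient field — Fu's Example 3.4, over `k = ℚ`,
`ν(y² - 2x²) > 2ν(x)`, shows Prop 3.3 fails for the given `S` when `k ≠ k̄`) and through Facts
3.1–3.2 as quoted for `k = k̄`. Lemma 1.4 (p. 618) holds in any regular local ring (coefficient
SET); Cor 2.4 (p. 621–622) in any regular local ring birationally dominated by a valuation ring,
for parameters `x₁, …, x_r` with rationally independent values — the monoidal transforms it uses
are centred at `(x_a, x_b)`, `a, b ≤ r`, with `ν(x_a) < ν(x_b)` (never equal, by independence),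
i.e. "positive EGPs" `x_b' = x_b / x_a` (p. 621), which need no residual rationality.

## The transported proof of `PrimaryTransformRankOne` (this file's; to be refereed as such)

Setting: `k` any field; `K/k` finitely generated of transcendence degree three, `L/K` finite;
`W` a valuation ring of `L/k` of rank one with `κ(W)/k` algebraic and `r := rat.rk W ≥ 2` (so
`r ∈ {2, 3}` by Abhyankar's inequality; `rat.rk (W ∩ K) = r` as `L/K` is algebraic); `W` admits a
local uniformization; `S₁` a local uniformization of `W`; `ν` the valuation of `W`,
`V := W ∩ K`. CLAIM: there is a local uniformization `S ⊇ S₁` of `W` with `Q := (m_S ∩ K)S`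
primary for `m_S`.
- (T0) [replaces Reduction 3.7 and the use of Fact 3.1 in Prop 3.8, p. 627–628] Pick
  `q₁, q₂, q₃ ∈ V` a transcendence basis of `K/k` and `w₁, …, w_r ∈ m_V` with `ν(w₁), …, ν(w_r)`
  rationally independent (`Γ_V ⊗ ℚ` has dimension `r` and is spanned by `ν(K^×)`; invert to make
  values positive). With `S₁ = A_𝔭` (`A` an affine model), `T := A[q, w]_{m_W ∩ A[q, w]}` is a local
  model of `W` containing `S₁`; by Cor 4.6 (`Cofinality`, any `k`) there is a local
  uniformization `S₂ ⊇ T` of `W`. `S₂` is regular, hence normal (Auslander–Buchsbaum / Serre),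
  so `S₂` is a normal local model of `W`; and for every normal local ring `S ⊇ S₂` of `L`,
  `R := S ∩ K` is normal, contains `q₁, q₂, q₃, w₁, …, w_r`, and has fraction field `K` (Fu's
  argument, p. 627 l. −6 – −1: `K` is algebraic over `Frac R`; for `t ∈ K` some `e ∈ R` makes `et`
  integral over `R`, hence `et ∈ S ∩ K = R`).
- (T1) [replaces Props 3.3 + 3.5 as used in the proof of Prop 3.8, p. 628 l. 9–13] Apply
  [CossartPiltant2008] Prop 8.1 (HAL p. 22; `MonomialUniformization`; any `k`; its printed proof:
  Cor 4.6 and Prop 4.1) to the normal local model `S₀ := S₂` and `f₀ := w₁⋯w_r ∈ S₀`, `f₀ ≠ 0`: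
  there are `f ∈ m_{S₀}` with `f₀ | f` in `S₀` and a local uniformization `S ⊇ S₀` of `W` with
  regular system of parameters `(x₁, x₂, x₃)`, `√(fS) = (x₁⋯x_r)S ⊇ m_{S₀}` and
  `ν(x₁), …, ν(x_r)` rationally independent.
- (T2) [Fu's display `w_i = x₁^{a_{i1}}⋯x_r^{a_{ir}} d_i`, p. 628 l. 12] `S` is a regular local
  ring, hence a UFD; `x₁, …, x_r` are pairwise non-associate primes of `S` and `√(fS) = (x₁⋯x_r)S`
  says they are exactly the prime divisors of `f`, so `f = ε·x₁^{b₁}⋯x_r^{b_r}`, `ε ∈ S^×`; as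
  `w_i | f₀ | f` in `S`, each `w_i = δ_i x₁^{a_{i1}}⋯x_r^{a_{ir}}` with `δ_i ∈ S^×`, `a_{ij} ∈ ℕ`.
- (T3) [Prop 3.8 verbatim, p. 628 l. 13–19] `ν(w_i) = Σ_j a_{ij} ν(x_j)` are independent, so
  `D := |det(a_{ij})| ≥ 1`; `adj(A)·A = det(A)·1` gives units `δ'_j ∈ S^×` with
  `x_j^D δ'_j ∈ K` (`j ≤ r`) — a Laurent monomial in the `w_i` — hence `x_j^D δ'_j ∈ m_S ∩ K` and
  `(x₁, …, x_r)S ⊆ √Q`, `ht Q ≥ r`. (†)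
- (T4) [`r = 3`: Thm 3.6 (1)] `m_S = (x₁, x₂, x₃) ⊆ √Q`: `Q` is `m_S`-primary and `S ⊇ S₁` is the
  required ring. Kernel: `contractedCentrePrimary_of_dagger`.
- (T5) [`r = 2 = n − 1`: Thm 3.6 (2), p. 628 l. −12 – p. 629, verbatim] `P := (x₁, x₂)S`,
  `Y := x₃`. If `ht Q = 3`, done. Else `Q ⊆ P` (a height-two minimal prime of `Q` contains
  `√Q ⊇ P`). Suppose no iterated monoidal transform `S'` of `S` along `ν` has `ht Q' ≥ 3`. Along
  transforms centred in `P` (positive EGPs, `Y` fixed, parameters `(x_a, x_b/x_a, x₃)`), (†) and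
  `Q' ⊆ P'` persist (p. 629 l. 1–5). `x₃` is algebraic over `K = Frac R` (T0), so some `a ∈ R`
  makes `a x₃` integral over `R`; `R` normal ⇒ its characteristic polynomial over `K` has
  coefficients in `R`, whence `0 ≠ N_{L/K}(a x₃) ∈ x₃S ∩ K ⊆ m_S ∩ K ⊆ Q ⊆ P`; write
  `N = x₃^t h`, `h ∈ S ∖ x₃S` (Krull), so `h ∈ P`. Lemma 1.4: `h = Σ a_i M_i` (units `a_i`,
  distinct monomials `M_i = s_i t_i`, `s_i` in `X = (x₁, x₂)`, `t_i` in `Y`); every `s_i` is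
  non-trivial since `S/P` is a discrete valuation ring with parameter `x̄₃` (a sum of units times
  distinct powers of `x̄₃` is non-zero). Order by `ν(s_i)`; `ν(s₁) = ⋯ = ν(s_{l₀})` forces
  `s₁ = ⋯ = s_{l₀}` (independence), so `t₁, …, t_{l₀}` are distinct. Cor 2.4: after an iterated
  transform `S'` centred in `P`, `s_{l₀} < s_{l₀+1} < ⋯` (divisibility) and the `x_j` are monomials
  in the new parameters; then `h = s₁(a + b)`, `a = Σ_{i ≤ l₀} a_i t_i`, `b ∈ P'`, and
  `a + b ∉ P'` (`S'/P'` a DVR in `x̄₃`). With `s₁ = x'₁^{g₁} x'₂^{g₂}` and (†) in `S'`: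
  `(x₃^t h)^{D'} / ∏_j (x'_j^{D'} δ'_j)^{g_j} = x₃^{tD'} (a+b)^{D'} ∏ δ'_j^{-g_j} ∈ K ∩ m_{S'} ⊆ Q' ⊆ P'`,
  but it is a product of elements outside the prime `P'` — contradiction. Hence some iterated
  monoidal transform `S' ⊇ S ⊇ S₁` along `ν` (again a local uniformization of `W`: regular centres,
  localised at the centre of `W`) has `ht Q' = 3`, i.e. `Q'` is `m_{S'}`-primary.
No step uses `κ(S) = k`, a coefficient field, `k = k̄`, or the characteristic. Used about `k`
and dimension: Prop 8.1 (whose proof is where `n = 3`, char `p`, enters: Prop 4.1) and `n = 3`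
in (T4)/(T5) (`r + 1 = n` makes `ht Q' ≥ r + 1` mean primary). The hypotheses "rank one" and
"`κ(W)/k` algebraic, LU(`W`)" are those of Prop 8.1; Fu's theorem has no rank hypothesis.

NOTHING here asserts or refutes a statement of [CossartPiltant2008]; Lemma 9.4 remains the
cited named fact `TamePrimeDescent`. Cell record: pub-hironaka GAPS §GA rows G7-A21.S,
G9-A21.S-R (residual (ii) `k ≠ k̄`), G13-A21.S-T.

## Sources
- [CossartPiltant2008] HAL hal-00139124v1: Lemma 9.4 and its proof (p. 29–30), Prop 8.1 (p. 22),
  Cor 4.6 (p. 15), Prop 4.1 (p. 13), §3 (p. 4: local models, `R̃`), Theorem 2.1 and the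
  reduction sentence of the introduction (p. 3, l. 17–18).
- [Fu1997] D. Fu, Local weak simultaneous resolution for high rational ranks, J. Algebra 194
  (1997) 614–630: Lemma 1.4 (p. 618), EGP/MDT dictionary (p. 621), Cor 2.4 (p. 621–622), §3
  standing hypotheses and Facts 3.1–3.2 (p. 624), Prop 3.3, Example 3.4, Prop 3.5 (p. 624–626),
  Thm 3.6, Reduction 3.7 (p. 627), Prop 3.8 and the proof of (2) (p. 628–629).
- M. Auslander, D. A. Buchsbaum, Unique factorization in regular local rings, PNAS 45 (1959)
  733–734 (regular local ⇒ UFD ⇒ normal), as used by [Fu1997] p. 629 ("`S` is a UFD").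
-/

noncomputable section

namespace Literature.AlgebraicGeometry.CossartPiltant200819.CP2008

open Literature.AlgebraicGeometry.Resolution IsLocalRing IntermediateField
open scoped Pointwise IntermediateField

universe u

/-! ### Fu's terminal step for `r = n = 3`: (†) for all parameters ⇒ `Q` is `N`-primary -/

section Dagger

variable {k : Type u} [Field k] (K : Type u) {L : Type u} [Field K] [Field L] [Algebra K L]
  [Algebra k L]

/-- **[Fu1997] Thm 3.6 (1) from Prop 3.8, case `r = n = 3`** (p. 628: "Thus `x₁, …, x_r ∈ √Q`",
and for `r = n` this is "`Q` is `N`-primary"), PROVED in the elementwise idiom of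
`ContractedCentrePrimary`, for ANY ground field: if `S ⊆ W` is a `k`-subalgebra of `L` whose
centre `N = {s ∈ S : W(s) > 0}` is generated by `x₁, x₂, x₃ ∈ N`, and for each `j` some power
`x_j^D` (`D ≥ 1`) times a unit `δ_j` of `S` lies in `K` (Fu's relations (†)), then every element
of `N` has a power in `Q = (N ∩ K)S`. (Pigeonhole on monomials: `(Σ aᵢxᵢ)^{3(M-1)+1} ∈ (xᵢ^M)S`,
`Ideal.sum_pow_mem_span_pow`.) [cite: Fu1997, Thm 3.6 (1) and Prop 3.8 (p. 628)] -/
theorem contractedCentrePrimary_of_dagger (W : ValuationSubring L) (S : Subalgebra k L)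
    (hSW : ∀ s ∈ S, s ∈ W) (x : Fin 3 → L) (hxS : ∀ i, x i ∈ S)
    (hxv : ∀ i, W.valuation (x i) < 1)
    (hgen : ∀ s ∈ S, W.valuation s < 1 → ∃ a : Fin 3 → L, (∀ i, a i ∈ S) ∧ s = ∑ i, a i * x i)
    (hdag : ∀ j, ∃ D : ℕ, 0 < D ∧ ∃ δ ∈ S, (∃ δ' ∈ S, δ * δ' = 1) ∧
      x j ^ D * δ ∈ Set.range (algebraMap K L)) :
    ContractedCentrePrimary K W S := by
  classical
  intro s hs
  set Q : Ideal S := Ideal.span {y : S | (y : L) ∈ Set.range (algebraMap K L) ∧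
      W.valuation (y : L) < 1} with hQ
  let x' : Fin 3 → S := fun i => ⟨x i, hxS i⟩
  -- (†) puts a power of each parameter in `Q`
  have hxQ : ∀ j, ∃ D : ℕ, 0 < D ∧ x' j ^ D ∈ Q := by
    intro j
    obtain ⟨D, hD, δ, hδS, ⟨δ', hδ'S, hδδ'⟩, hK⟩ := hdag j
    obtain ⟨D₀, rfl⟩ := Nat.exists_eq_succ_of_ne_zero hD.ne'
    refine ⟨D₀ + 1, hD, ?_⟩
    have hmS : x j ^ D₀ * δ ∈ S := S.mul_mem (S.pow_mem (hxS j) D₀) hδS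
    have hyS : x j ^ (D₀ + 1) * δ ∈ S := S.mul_mem (S.pow_mem (hxS j) _) hδS
    have hyv : W.valuation (x j ^ (D₀ + 1) * δ) < 1 := by
      have hle : W.valuation (x j ^ D₀ * δ) ≤ 1 := (W.valuation_le_one_iff _).mpr (hSW _ hmS)
      have heq : x j ^ (D₀ + 1) * δ = x j * (x j ^ D₀ * δ) := by ring
      rw [heq, map_mul]
      calc W.valuation (x j) * W.valuation (x j ^ D₀ * δ)
          ≤ W.valuation (x j) * 1 := mul_le_mul' le_rfl hle
        _ < 1 := by rw [mul_one]; exact hxv j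
    have hy : (⟨x j ^ (D₀ + 1) * δ, hyS⟩ : S) ∈ Q := Ideal.subset_span ⟨hK, hyv⟩
    have hfac : x' j ^ (D₀ + 1) = ⟨x j ^ (D₀ + 1) * δ, hyS⟩ * ⟨δ', hδ'S⟩ := by
      apply Subtype.ext
      simp only [x', SubmonoidClass.mk_pow, Subalgebra.coe_mul]
      rw [mul_assoc, hδδ', mul_one]
    rw [hfac]
    exact Q.mul_mem_right _ hy
  choose D hDpos hDQ using hxQ
  -- a common exponent `M ≥ 1`
  set M : ℕ := ∑ i, D i with hM
  have hDle : ∀ i, D i ≤ M := fun i =>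
    Finset.single_le_sum (f := D) (fun j _ => Nat.zero_le _) (Finset.mem_univ i)
  have hMpos : 1 ≤ M := le_trans (hDpos 0) (hDle 0)
  have hxM : ∀ i, x' i ^ M ∈ Q := fun i => by
    have h := Q.mul_mem_right (x' i ^ (M - D i)) (hDQ i)
    rwa [← pow_add, Nat.add_sub_cancel' (hDle i)] at h
  -- write `s = Σ aᵢ xᵢ` in `S`
  obtain ⟨a, haS, hsum⟩ := hgen s s.2 hs
  let a' : Fin 3 → S := fun i => ⟨a i, haS i⟩
  have hs' : s = ∑ i, a' i * x' i := by
    apply Subtype.ext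
    rw [hsum]
    simp only [a', x', AddSubmonoidClass.coe_finsetSum, Subalgebra.coe_mul]
  -- pigeonhole on monomials
  refine ⟨(Finset.univ : Finset (Fin 3)).card * (M - 1) + 1, ?_⟩
  have hmem := Ideal.sum_pow_mem_span_pow (Finset.univ : Finset (Fin 3))
    (fun i => a' i * x' i) (M - 1)
  rw [hs']
  refine (Ideal.span_le.mpr ?_) hmem
  rintro _ ⟨i, -, rfl⟩
  show (a' i * x' i) ^ (M - 1 + 1) ∈ Q
  rw [Nat.sub_add_cancel hMpos, mul_pow]
  exact Q.mul_mem_left _ (hxM i)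

end Dagger

/-! ### Fu's Theorem 3.6 for `n = 3`, `r ≥ 2`, any `k`, rank one (transport; hypothesis only) -/

/-- **Primary contraction over an arbitrary ground field, rank one** — this formalisation's
TRANSPORT of [Fu1997, Thm 3.6] (J. Algebra 194, p. 627: `k = k̄`, `n ≤ 3` in characteristic
`p > 0`, `ν` of `k`-dimension zero and rational rank `r`; for `r ≥ n − 1` an iterated monoidal
transform of `S` along `ν` has `Q = (N ∩ K)S` primary for `N`) to the setting of
[CossartPiltant2008] Lemma 9.4; NOT a printed statement, hypothesis only. Statement:
`FuPrimaryTransform` with the hypothesis `IsAlgClosed k` REMOVED and `W` of rank one ADDED —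
`K/k` finitely generated, `L/K` finite, `trdeg_k L = 3`, `W` a rank-one valuation ring of `L/k`
with `κ(W)/k` algebraic and rational rank `≥ 2`; every local uniformization `S` of `W` lies in a
local uniformization `S'` of `W` with `(m_{S'} ∩ K)S'` primary for `m_{S'}`. Transported proof
(module docstring, (T0)–(T5)): Fu's Props 3.3/3.5 — the only steps using `k = k̄` (Example 3.4)
— are replaced by [CossartPiltant2008] Prop 8.1 (`MonomialUniformization`) applied to a normal
local model `S₀ ⊇ S` containing `w₁, …, w_r ∈ K` with independent values and `f₀ = w₁⋯w_r`, and
Fact 3.1 by Cor 4.6 (`Cofinality`); Prop 3.8 and the proof of (2) (Lemma 1.4, Cor 2.4, `S` a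
UFD, `R = S ∩ K` normal with `Frac R = K`, `S/P` regular) are unchanged and use no hypothesis
on `k`. [cite: Fu1997, Thm 3.6 (p. 627–629), transported via CossartPiltant2008 Prop 8.1 (HAL p. 22) and Cor 4.6 (HAL p. 15)] -/
def PrimaryTransformRankOne : Prop :=
  ∀ (k K : Type u) [Field k] [Field K] [Algebra k K], (⊤ : IntermediateField k K).FG →
    ∀ (L : Type u) [Field L] [Algebra K L] [Algebra k L] [IsScalarTower k K L],
      FiniteDimensional K L → Algebra.trdeg k L = 3 →
      ∀ (W : ValuationSubring L) (hk : ∀ c : k, algebraMap k L c ∈ W),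
        Nonempty W.valuation.RankOne → residueTrdeg k W hk = 0 → (2 : Cardinal) ≤ ratRank W →
        ∀ S : Subalgebra k L, IsLocalUniformizationOf k L W S →
          ∃ S' : Subalgebra k L, IsLocalUniformizationOf k L W S' ∧ S ≤ S' ∧
            ContractedCentrePrimary K W S'

/-- Fu's printed theorem gives the transported statement for `k` algebraically closed (then the
rank-one hypothesis is simply not used). [folklore] -/
theorem primaryTransformRankOne_of_fu_of_isAlgClosed (hFu : FuPrimaryTransform.{u})
    {k K : Type u} [Field k] [Field K] [Algebra k K] (hac : IsAlgClosed k)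
    (hfg : (⊤ : IntermediateField k K).FG)
    {L : Type u} [Field L] [Algebra K L] [Algebra k L] [IsScalarTower k K L]
    [FiniteDimensional K L] (htrL : Algebra.trdeg k L = 3)
    (W : ValuationSubring L) (hk : ∀ c : k, algebraMap k L c ∈ W)
    (hres : residueTrdeg k W hk = 0) (hrr : (2 : Cardinal) ≤ ratRank W)
    (S : Subalgebra k L) (hS : IsLocalUniformizationOf k L W S) :
    ∃ S' : Subalgebra k L, IsLocalUniformizationOf k L W S' ∧ S ≤ S' ∧
      ContractedCentrePrimary K W S' :=
  hFu k K hac hfg L inferInstance htrL W hk hres hrr S hS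

/-! ### (S3\*) and Lemma 9.4 for rational rank `≥ 2` over an arbitrary ground field -/

/-- **(S3\*) for `W` fixed by `Gal(L/K)`, any `k`, rank one, rational rank `≥ 2`** (PROVED
bookkeeping; compare `gStableUniformizationAbove_of_primary`, which needs `k = k̄`): `R̃₀ ⊆ T`
(`NormalModelAboveLe`), `T ⊆ S₁` (Cor 4.6, `Cofinality`), `S₁ ⊆ S` with `m_S`-primary contracted
centre (`PrimaryTransformRankOne`), `σS = S` (`ConjugateStability`).
[cite: CossartPiltant2008, Lemma 9.4 proof (HAL p. 30, l. 14–16), Cor 4.6 (HAL p. 15)] -/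
theorem gStableUniformizationAbove_of_primary_rankOne (hcof : Cofinality.{u})
    (hnm : NormalModelAboveLe.{u}) (hFu : PrimaryTransformRankOne.{u})
    (hst : ConjugateStability.{u})
    {k K : Type u} [Field k] [Field K] [Algebra k K]
    (hfg : (⊤ : IntermediateField k K).FG) (htr : Algebra.trdeg k K = 3)
    {L : Type u} [Field L] [Algebra K L] [Algebra k L] [IsScalarTower k K L]
    [FiniteDimensional K L] (W : ValuationSubring L) (hk : ∀ c : k, algebraMap k L c ∈ W)
    (hrk : Nonempty W.valuation.RankOne) (hres : residueTrdeg k W hk = 0)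
    (hrr : (2 : Cardinal) ≤ ratRank W)
    (hfix : ∀ σ : L ≃ₐ[K] L, σ • W = W) (hLU : IsLocallyUniformizable k L W)
    (R₀ : Subalgebra k K) (hR₀ : IsNormalLocalModelOf k K (W.comap (algebraMap K L)) R₀) :
    GStableUniformizationAbove (K := K) W R₀ := by
  haveI : Algebra.IsAlgebraic K L := Algebra.IsAlgebraic.of_finite K L
  have hfgL : (⊤ : IntermediateField k L).FG := intermediateField_fg_top_of_finite hfg
  have htrL : Algebra.trdeg k L = 3 := (trdeg_eq_of_isAlgebraic' (K := K) (L := L)).trans htr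
  obtain ⟨T, hT, hRT⟩ := hnm k K hfg L inferInstance W hk R₀ hR₀
  obtain ⟨S₁, hS₁, hTS₁⟩ := hcof k L hfgL htrL W hk hLU T hT
  obtain ⟨S, hS, hS₁S, hprim⟩ := hFu k K hfg L inferInstance htrL W hk hrk hres hrr S₁ hS₁
  exact ⟨S, hS, fun x hx => hS₁S (hTS₁ (hRT hx)),
    fun σ => hst k K L W hk hres σ (hfix σ) S hS hprim⟩

/-- **Cossart–Piltant 2008, Lemma 9.4 restricted to rational rank `≥ 2`** (any ground field):
`TamePrimeDescent` (HAL p. 29) with the extra hypothesis `rat.rk W ≥ 2`; between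
`TamePrimeDescent` and `TamePrimeDescentHighRank` (`k = k̄`). A special case of the lemma; proved
from printed statements, `ConjugateStability` and the transport `PrimaryTransformRankOne` in
`tamePrimeDescentRatRankTwo_of_leaves`. [cite: CossartPiltant2008, Lemma 9.4 (HAL p. 29), special case] -/
def TamePrimeDescentRatRankTwo : Prop :=
  ∀ (k K : Type u) [Field k] [Field K] [Algebra k K],
    (⊤ : IntermediateField k K).FG → Algebra.trdeg k K = 3 →
    ∀ (L : Type u) [Field L] [Algebra K L] [Algebra k L] [IsScalarTower k K L],
      FiniteDimensional K L → IsGalois K L →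
      (Module.finrank K L).Prime → ((Module.finrank K L : ℕ) : K) ≠ 0 →
      ∀ (W : ValuationSubring L) (hk : ∀ c : k, algebraMap k L c ∈ W),
        Nonempty W.valuation.RankOne → residueTrdeg k W hk = 0 → (2 : Cardinal) ≤ ratRank W →
          IsLocallyUniformizable k L W → IsLocallyUniformizable k K (W.comap (algebraMap K L))

/-- The rational-rank-`≥ 2` statement is a special case of Lemma 9.4. [folklore] -/
theorem TamePrimeDescent.ratRankTwo (h : TamePrimeDescent.{u}) : TamePrimeDescentRatRankTwo.{u} :=
  fun k K _ _ _ hfg htr L _ _ _ _ hfd hgal hpr hl W hk hrk hres _ hLU =>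
    h k K hfg htr L hfd hgal hpr hl W hk hrk hres hLU

/-- … and specialises to the `k = k̄` statement of `StableModelCriterion2008`. [folklore] -/
theorem TamePrimeDescentRatRankTwo.highRank (h : TamePrimeDescentRatRankTwo.{u}) :
    TamePrimeDescentHighRank.{u} :=
  fun k K _ _ _ _ hfg htr L _ _ _ _ hfd hgal hpr hl W hk hrk hres hrr hLU =>
    h k K hfg htr L hfd hgal hpr hl W hk hrk hres hrr hLU

/-- **Lemma 9.4 for rational rank `≥ 2` over an arbitrary ground field, from printed statements,
conjugate stability and the transported primary contraction** (PROVED): Prop 9.3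
(`DescentBelowInertiaField`), HAL p. 30 l. 16–65 (`TamePrimeDescentViaStableModel`), Cor 4.6
(`Cofinality`), `R̃₀` a local model (`NormalModelAboveLe`), `PrimaryTransformRankOne` and
`ConjugateStability` give `TamePrimeDescentRatRankTwo`: in the case `G = G_i(W/V)` every `σ`
fixes `W` and (S3\*) holds by `gStableUniformizationAbove_of_primary_rankOne`; otherwise
`descent_of_inertiaGroup_ne_top`. [cite: CossartPiltant2008, Lemma 9.4 (HAL p. 29–30)] -/
theorem tamePrimeDescentRatRankTwo_of_leaves (h93 : DescentBelowInertiaField.{u})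
    (h₁ : TamePrimeDescentViaStableModel.{u}) (hcof : Cofinality.{u})
    (hnm : NormalModelAboveLe.{u}) (hFu : PrimaryTransformRankOne.{u})
    (hst : ConjugateStability.{u}) :
    TamePrimeDescentRatRankTwo.{u} := by
  intro k K _ _ _ hfg htr L _ _ _ _ hfd hgal hpr hl W hk hrk hres hrr hLU
  haveI := hfd
  haveI := hgal
  by_cases htop : inertiaGroup (K := K) W = ⊤
  · have hfix : ∀ σ : L ≃ₐ[K] L, σ • W = W := fun σ => by
      have hσ : σ ∈ inertiaGroup (K := K) W := by rw [htop]; exact Subgroup.mem_top σ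
      exact ((mem_inertiaGroup_iff' W σ).mp hσ).1
    exact h₁ k K hfg htr L hfd hgal hpr hl W hk hrk hres
      (fun R₀ hR₀ => gStableUniformizationAbove_of_primary_rankOne hcof hnm hFu hst hfg htr W hk
        hrk hres hrr hfix hLU R₀ hR₀)
  · exact descent_of_inertiaGroup_ne_top h93 hfg htr hpr W hk hrk hres htop hLU

/-! ### What is left of (S3\*): the rational-rank-one residual, and the full lemma from it -/

/-- **(S3\*) in rational rank one** — the residual of `GStableUniformizationInertial` not
covered by the transport: the stability statement of HAL p. 30, l. 14–16 for inertial rank-one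
`W` of the setting of Lemma 9.4 with `rat.rk W < 2` (i.e. `= 1`: `e = l`, `Γ_V ⊂ Γ_W` of index
`l`, `κ(W) = κ(V)`). Not established by the printed text nor by [Fu1997] (whose Thm 3.6 (2) gives
only `ht Q ≥ 2` for `r = 1`); hypothesis only (pub-hironaka GAPS rows G7-A21.S, G9-A21.S-R (i)).
[cite: CossartPiltant2008, Lemma 9.4 proof (HAL p. 30, l. 11–16)] -/
def GStableUniformizationInertialRankOne : Prop :=
  ∀ (k K : Type u) [Field k] [Field K] [Algebra k K], (⊤ : IntermediateField k K).FG →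
    Algebra.trdeg k K = 3 →
    ∀ (L : Type u) [Field L] [Algebra K L] [Algebra k L] [IsScalarTower k K L],
      FiniteDimensional K L → IsGalois K L →
      (Module.finrank K L).Prime → ((Module.finrank K L : ℕ) : K) ≠ 0 →
      ∀ (W : ValuationSubring L) (hk : ∀ c : k, algebraMap k L c ∈ W),
        Nonempty W.valuation.RankOne → residueTrdeg k W hk = 0 → ratRank W < 2 →
          (∀ σ : L ≃ₐ[K] L, InInertiaGroup K W σ) →
          IsLocallyUniformizable k L W →
          ∀ R₀ : Subalgebra k K, IsNormalLocalModelOf k K (W.comap (algebraMap K L)) R₀ →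
            GStableUniformizationAbove (K := K) W R₀

/-- `GStableUniformizationInertial` trivially gives its rational-rank-one case. [folklore] -/
theorem GStableUniformizationInertial.rankOne (h : GStableUniformizationInertial.{u}) :
    GStableUniformizationInertialRankOne.{u} :=
  fun k K _ _ _ hfg htr L _ _ _ _ hfd hgal hpr hl W hk hrk hres _ hin hLU R₀ hR₀ =>
    h k K hfg htr L hfd hgal hpr hl W hk hrk hres hin hLU R₀ hR₀

/-- **(S3\*) for inertial `W`, any `k`, from the leaves and the rank-one residual** (PROVED
bookkeeping): dichotomy `rat.rk W ≥ 2` (transport: `gStableUniformizationAbove_of_primary_rankOne`,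
every inertial `σ` fixing `W`) / `rat.rk W < 2` (`GStableUniformizationInertialRankOne`).
[cite: CossartPiltant2008, Lemma 9.4 proof (HAL p. 30, l. 11–16)] -/
theorem gStableUniformizationInertial_of_leaves (hcof : Cofinality.{u})
    (hnm : NormalModelAboveLe.{u}) (hFu : PrimaryTransformRankOne.{u})
    (hst : ConjugateStability.{u}) (h1 : GStableUniformizationInertialRankOne.{u}) :
    GStableUniformizationInertial.{u} := by
  intro k K _ _ _ hfg htr L _ _ _ _ hfd hgal hpr hl W hk hrk hres hin hLU R₀ hR₀
  haveI := hfd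
  rcases le_or_gt (2 : Cardinal) (ratRank W) with hrr | hrr
  · have hfix : ∀ σ : L ≃ₐ[K] L, σ • W = W := fun σ =>
      ((mem_inertiaGroup_iff' W σ).mp ((mem_inertiaGroup_iff W σ).mpr (hin σ))).1
    exact gStableUniformizationAbove_of_primary_rankOne hcof hnm hFu hst hfg htr W hk hrk hres
      hrr hfix hLU R₀ hR₀
  · exact h1 k K hfg htr L hfd hgal hpr hl W hk hrk hres hrr hin hLU R₀ hR₀

/-- **Lemma 9.4 (`TamePrimeDescent`) over an arbitrary ground field from printed statements,
conjugate stability, the transported primary contraction and the rational-rank-one residual**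
(PROVED bookkeeping): `tamePrimeDescent_of_viaStableModel_of_inertia` with
`gStableUniformizationInertial_of_leaves`. After this file the binder (S3\*) of the printed proof
is reduced, over any `k`, to: `ConjugateStability` (criterion, argued in
`StableModelCriterion2008` by Zariski's Main Theorem), `PrimaryTransformRankOne` (transport of
[Fu1997, Thm 3.6], this file) and `GStableUniformizationInertialRankOne` (open residual).
[cite: CossartPiltant2008, Lemma 9.4 (HAL p. 29–30)] -/
theorem tamePrimeDescent_of_leaves_of_rankOne (h93 : DescentBelowInertiaField.{u})
    (h₁ : TamePrimeDescentViaStableModel.{u}) (hcof : Cofinality.{u})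
    (hnm : NormalModelAboveLe.{u}) (hFu : PrimaryTransformRankOne.{u})
    (hst : ConjugateStability.{u}) (h1 : GStableUniformizationInertialRankOne.{u}) :
    TamePrimeDescent.{u} :=
  tamePrimeDescent_of_viaStableModel_of_inertia h93 h₁
    (gStableUniformizationInertial_of_leaves hcof hnm hFu hst h1)

/-! ### The leaf `NormalModelAboveLe` discharged (`NormalModelAbove2008.normalModelAboveLe_holds`) -/

/-- **(S3\*) for `W` fixed by `Gal(L/K)`, any `k`, rank one, rational rank `≥ 2`, with the leaf
`NormalModelAboveLe` DISCHARGED** (PROVED): `gStableUniformizationAbove_of_primary_rankOne` with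
`normalModelAboveLe_holds` (HAL §3, p. 4 l. 20–23; Prop 6.2, p. 17 l. 43–44: `R̃` is a local
model of `W`). Remaining hypotheses: Cor 4.6 (`Cofinality`), the transport
`PrimaryTransformRankOne`, the criterion `ConjugateStability`.
[cite: CossartPiltant2008, Lemma 9.4 proof (HAL p. 30, l. 14–16), Section 3 (HAL p. 4, l. 20–23)] -/
theorem gStableUniformizationAbove_of_primary_rankOne' (hcof : Cofinality.{u})
    (hFu : PrimaryTransformRankOne.{u}) (hst : ConjugateStability.{u})
    {k K : Type u} [Field k] [Field K] [Algebra k K]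
    (hfg : (⊤ : IntermediateField k K).FG) (htr : Algebra.trdeg k K = 3)
    {L : Type u} [Field L] [Algebra K L] [Algebra k L] [IsScalarTower k K L]
    [FiniteDimensional K L] (W : ValuationSubring L) (hk : ∀ c : k, algebraMap k L c ∈ W)
    (hrk : Nonempty W.valuation.RankOne) (hres : residueTrdeg k W hk = 0)
    (hrr : (2 : Cardinal) ≤ ratRank W)
    (hfix : ∀ σ : L ≃ₐ[K] L, σ • W = W) (hLU : IsLocallyUniformizable k L W)
    (R₀ : Subalgebra k K) (hR₀ : IsNormalLocalModelOf k K (W.comap (algebraMap K L)) R₀) :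
    GStableUniformizationAbove (K := K) W R₀ :=
  gStableUniformizationAbove_of_primary_rankOne hcof normalModelAboveLe_holds hFu hst hfg htr W hk
    hrk hres hrr hfix hLU R₀ hR₀

/-- **Lemma 9.4 for rational rank `≥ 2` over an arbitrary ground field from THREE printed
statements, conjugate stability and the transport** (PROVED): `tamePrimeDescentRatRankTwo_of_leaves`
with the leaf `NormalModelAboveLe` discharged by `normalModelAboveLe_holds`.
[cite: CossartPiltant2008, Lemma 9.4 (HAL p. 29–30)] -/
theorem tamePrimeDescentRatRankTwo_of_leaves' (h93 : DescentBelowInertiaField.{u})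
    (h₁ : TamePrimeDescentViaStableModel.{u}) (hcof : Cofinality.{u})
    (hFu : PrimaryTransformRankOne.{u}) (hst : ConjugateStability.{u}) :
    TamePrimeDescentRatRankTwo.{u} :=
  tamePrimeDescentRatRankTwo_of_leaves h93 h₁ hcof normalModelAboveLe_holds hFu hst

/-- **(S3\*) for inertial `W`, any `k`, with `NormalModelAboveLe` discharged** (PROVED):
`gStableUniformizationInertial_of_leaves` with `normalModelAboveLe_holds`; remaining hypotheses
`Cofinality`, `PrimaryTransformRankOne`, `ConjugateStability`, `GStableUniformizationInertialRankOne`.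
[cite: CossartPiltant2008, Lemma 9.4 proof (HAL p. 30, l. 11–16)] -/
theorem gStableUniformizationInertial_of_leaves' (hcof : Cofinality.{u})
    (hFu : PrimaryTransformRankOne.{u}) (hst : ConjugateStability.{u})
    (h1 : GStableUniformizationInertialRankOne.{u}) :
    GStableUniformizationInertial.{u} :=
  gStableUniformizationInertial_of_leaves hcof normalModelAboveLe_holds hFu hst h1

/-- **Lemma 9.4 (`TamePrimeDescent`) over an arbitrary ground field — final form of this cell's
reduction** (PROVED bookkeeping): from the printed statements Prop 9.3
(`DescentBelowInertiaField`), HAL p. 30 l. 16–65 (`TamePrimeDescentViaStableModel`) and Cor 4.6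
(`Cofinality`), the criterion `ConjugateStability` (Zariski's Main Theorem, argued in
`StableModelCriterion2008`), the transport `PrimaryTransformRankOne` of [Fu1997, Thm 3.6] (this
file) and the open rational-rank-one residual `GStableUniformizationInertialRankOne`; the leaf
`NormalModelAboveLe` of `tamePrimeDescent_of_leaves_of_rankOne` is discharged by
`normalModelAboveLe_holds`. [cite: CossartPiltant2008, Lemma 9.4 (HAL p. 29–30)] -/
theorem tamePrimeDescent_of_leaves_of_rankOne' (h93 : DescentBelowInertiaField.{u})
    (h₁ : TamePrimeDescentViaStableModel.{u}) (hcof : Cofinality.{u})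
    (hFu : PrimaryTransformRankOne.{u}) (hst : ConjugateStability.{u})
    (h1 : GStableUniformizationInertialRankOne.{u}) :
    TamePrimeDescent.{u} :=
  tamePrimeDescent_of_leaves_of_rankOne h93 h₁ hcof normalModelAboveLe_holds hFu hst h1

end Literature.AlgebraicGeometry.CossartPiltant200819.CP2008

end
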